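import Mathlib
import Literature.MathematicalPhysics.QuantumLattice.HubbardEffectiveActionCT

/-!
# Crux `SeededBrokenRegimeBoseFermiPinned` (stmt-HubbardSuperconductivity-14047), line `seed-strength-flow`:
# stub S3 `stub_seedSliceCovarianceBound` — the seed-slice covariance above scale `Λ₀` is entrywise small

Support file (`--supports stmt-HubbardSuperconductivity-14047`; no definition).  The line reaches the seed `h`
from the anchor `h₀` by one Gaussian convolution with the seed-slice covariance
`δC := C^{K}_{>Λ₀, h} − C^{K}_{>Λ₀, h₀}` (`hubbardCovAboveCT`).  Given the first lemma of the line (S1, taken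
here as a HYPOTHESIS: above a fermionic scale `Λ`, `ω² + e_K² ≥ Λ²`, every entry of the seeded Nambu propagator
`nambuPropagatorCT` is differentiable in the seed with `‖∂_h G_ab‖ ≤ |φ_d|/Λ²`), every entry of `δC` is bounded
by `32√2 · βL² · |h − h₀| / Λ₀²`:

* the symmetrised weight `½(w(k_X) + w(k_Y))` of `hubbardCovAboveCT` is `h`-free and lies in `[0, 1]`
  (`salmhoferCutoff_mem_Icc`); if it vanishes the entry of `δC` is `0`;
* otherwise one of the two weights is nonzero, and Salmhofer's `χ₂` vanishes on `[0, ¼]`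
  (`salmhoferCutoff_of_le`), so that momentum satisfies `ω² + e_K² > Λ₀²/4 = (Λ₀/2)²`
  (`sq_half_le_of_weight_ne_zero`); the Nambu relabelling `toNambu` replaces `k` by `±k`, which does not
  change `ω² + e_K²` (`matsubaraFreq_rev`, `nambuXiCT_neg`; `den_toNambu`), and inside the Kronecker delta of
  `nambuTwoPointCT` the two Nambu momenta agree;
* S1 at scale `Λ := Λ₀/2` and the mean-value inequality on `ℝ` (`Convex.norm_image_sub_le_of_norm_deriv_le`)
  give `‖G_h − G_{h₀}‖ ≤ 4|φ_d| |h − h₀|/Λ₀² ≤ 16√2 |h − h₀|/Λ₀²` per entry (`|φ_d| ≤ 4√2`,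
  `abs_dWaveSymbol_le`), hence `βL² · 16√2 |h − h₀|/Λ₀²` per `nambuTwoPointCT` term and twice that for the
  antisymmetrised `hubbardTwoPointCT = -hubbardCovarianceCT` entry.
-/

set_option linter.dupNamespace false -- Summit.<S>.<S> doubles the summit name (tree convention)

namespace Summit.HubbardSuperconductivity.HubbardSuperconductivity.Theorems.AposterioriCapRgSeededBrokenRegimeBoseFermiPinned

open Literature.MathematicalPhysics.QuantumLattice Literature.Probability.LatticeModels GrassmannAlgebra

/-- `|φ_d(p)| = 2√2 |cos p₁ − cos p₂| ≤ 4√2`. [folklore] -/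
private theorem abs_dWaveSymbol_le (L : ℕ) (p : TorusSite 2 L) : |dWaveSymbol L p| ≤ 4 * Real.sqrt 2 := by
  rw [dWaveSymbol, abs_mul, abs_mul, abs_two, abs_of_nonneg (Real.sqrt_nonneg 2)]
  have h1 := Real.abs_cos_le_one (latticeMomentum L p 0)
  have h2 := Real.abs_cos_le_one (latticeMomentum L p 1)
  have h3 : |Real.cos (latticeMomentum L p 0) - Real.cos (latticeMomentum L p 1)| ≤ 2 :=
    (abs_sub _ _).trans (by linarith)
  nlinarith [Real.sqrt_nonneg 2, abs_nonneg (Real.cos (latticeMomentum L p 0) - Real.cos (latticeMomentum L p 1))]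

/-- The mean-value inequality on `ℝ` for one entry of the seeded propagator: an everywhere-differentiable
entry with `‖∂_h G_ab‖ ≤ C` is `C`-Lipschitz in the seed. [folklore] -/
private theorem norm_propagator_sub_le {L M : ℕ} {β μ : ℝ} {K : TrigPolyC4v} {k : FreqMomentum L M}
    {i j : Fin 2} {C : ℝ}
    (hd : ∀ x : ℝ, DifferentiableAt ℝ (fun h' : ℝ => nambuPropagatorCT L M β μ h' K k i j) x ∧
        ‖deriv (fun h' : ℝ => nambuPropagatorCT L M β μ h' K k i j) x‖ ≤ C)
    (h h₀ : ℝ) :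
    ‖nambuPropagatorCT L M β μ h K k i j - nambuPropagatorCT L M β μ h₀ K k i j‖ ≤ C * |h - h₀| := by
  have hmv := Convex.norm_image_sub_le_of_norm_deriv_le
    (f := fun h' : ℝ => nambuPropagatorCT L M β μ h' K k i j) (s := Set.univ)
    (fun x _ => (hd x).1) (fun x _ => (hd x).2) convex_univ (Set.mem_univ h₀) (Set.mem_univ h)
  simpa only [Real.norm_eq_abs] using hmv

/-- If the weight of a momentum above scale `Λ₀ > 0` does not vanish, the momentum lies above `Λ₀/2`:
`(Λ₀/2)² ≤ ω² + e_K²` (contrapositive of `χ₂ = 0` on `[0, ¼]`). [folklore] -/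
private theorem sq_half_le_of_weight_ne_zero {L M : ℕ} {β μ Λ₀ : ℝ} {K : TrigPolyC4v} (hΛ₀ : 0 < Λ₀)
    {k : FreqMomentum L M} (hw : hubbardCutoffWeightCT L M β μ K Λ₀ k ≠ 0) :
    (Λ₀ / 2) ^ 2 ≤ matsubaraFreq β M k.1 ^ 2 + nambuXiCT L μ K k.2 ^ 2 := by
  by_contra hlt
  push Not at hlt
  apply hw
  rw [hubbardCutoffWeightCT]
  apply salmhoferCutoff_of_le
  rw [div_le_iff₀ (by positivity)]
  nlinarith [hlt]

/-- The Nambu relabelling replaces `k` by `±k`, which does not change `ω² + e_K²`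
(`ω_{rev i} = -ω_i`, `e_K(-k⃗) = e_K(k⃗)`). [folklore] -/
private theorem den_toNambu {L M : ℕ} [NeZero L] (β μ : ℝ) (K : TrigPolyC4v) (X : HubbardFieldIdx L M) :
    matsubaraFreq β M (toNambu X).1.1.1 ^ 2 + nambuXiCT L μ K (toNambu X).1.1.2 ^ 2 =
      matsubaraFreq β M (momentumOf L M X).1 ^ 2 + nambuXiCT L μ K (momentumOf L M X).2 ^ 2 := by
  unfold toNambu momentumOf
  split_ifs
  · rfl
  · simp only [FreqMomentum.neg, matsubaraFreq_rev, neg_sq, nambuXiCT_neg]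

/-- One ordered Nambu two-point term: if one of the two Nambu momenta lies above `Λ₀/2`, then (the Kronecker
delta forcing the momenta to agree) S1 at scale `Λ₀/2` and the mean-value inequality give
`‖N_h(A,B) − N_{h₀}(A,B)‖ ≤ βL² · 16√2 |h − h₀| / Λ₀²`. [folklore] -/
private theorem norm_nambuTwoPointCT_sub_le {L M : ℕ} {β μ Λ₀ : ℝ} {K : TrigPolyC4v} (hβ : 0 < β)
    (hΛ₀ : 0 < Λ₀)
    (hS : ∀ (k : FreqMomentum L M) (i j : Fin 2) (x : ℝ),
      (Λ₀ / 2) ^ 2 ≤ matsubaraFreq β M k.1 ^ 2 + nambuXiCT L μ K k.2 ^ 2 →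
        DifferentiableAt ℝ (fun h' : ℝ => nambuPropagatorCT L M β μ h' K k i j) x ∧
        ‖deriv (fun h' : ℝ => nambuPropagatorCT L M β μ h' K k i j) x‖ ≤
          |dWaveSymbol L k.2| / (Λ₀ / 2) ^ 2)
    (A B : (FreqMomentum L M × Fin 2) × Fin 2)
    (hAB : (Λ₀ / 2) ^ 2 ≤ matsubaraFreq β M A.1.1.1 ^ 2 + nambuXiCT L μ K A.1.1.2 ^ 2 ∨
      (Λ₀ / 2) ^ 2 ≤ matsubaraFreq β M B.1.1.1 ^ 2 + nambuXiCT L μ K B.1.1.2 ^ 2)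
    (h h₀ : ℝ) :
    ‖nambuTwoPointCT L M β μ h K A B - nambuTwoPointCT L M β μ h₀ K A B‖ ≤
      β * (L : ℝ) ^ 2 * (16 * Real.sqrt 2 * |h - h₀| / Λ₀ ^ 2) := by
  have hrhs : 0 ≤ β * (L : ℝ) ^ 2 * (16 * Real.sqrt 2 * |h - h₀| / Λ₀ ^ 2) := by positivity
  unfold nambuTwoPointCT
  split_ifs with hc
  · obtain ⟨-, -, hk⟩ := hc
    have hD : (Λ₀ / 2) ^ 2 ≤ matsubaraFreq β M A.1.1.1 ^ 2 + nambuXiCT L μ K A.1.1.2 ^ 2 := by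
      rcases hAB with hA | hB
      · exact hA
      · rw [hk]; exact hB
    rw [← mul_sub, norm_mul, Complex.norm_real, Real.norm_eq_abs, abs_of_nonneg (by positivity)]
    refine mul_le_mul_of_nonneg_left ?_ (by positivity)
    refine (norm_propagator_sub_le (fun x => hS A.1.1 A.1.2 B.1.2 x hD) h h₀).trans ?_
    have hφ := abs_dWaveSymbol_le L A.1.1.2
    have hre : |dWaveSymbol L A.1.1.2| / (Λ₀ / 2) ^ 2 * |h - h₀| =
        4 * |dWaveSymbol L A.1.1.2| * |h - h₀| / Λ₀ ^ 2 := by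
      field_simp
      ring
    rw [hre]
    exact div_le_div_of_nonneg_right (by nlinarith [abs_nonneg (h - h₀)]) (by positivity)
  · simpa using hrhs

/-- The antisymmetrised two-point entry: if one of the momenta `k_X`, `k_Y` has nonzero weight above `Λ₀`, then
`‖T_h(X,Y) − T_{h₀}(X,Y)‖ ≤ 32√2 · βL² |h − h₀| / Λ₀²`. [folklore] -/
private theorem norm_hubbardTwoPointCT_sub_le {L M : ℕ} [NeZero L] {β μ Λ₀ : ℝ} {K : TrigPolyC4v} (hβ : 0 < β)
    (hΛ₀ : 0 < Λ₀)
    (hS : ∀ (k : FreqMomentum L M) (i j : Fin 2) (x : ℝ),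
      (Λ₀ / 2) ^ 2 ≤ matsubaraFreq β M k.1 ^ 2 + nambuXiCT L μ K k.2 ^ 2 →
        DifferentiableAt ℝ (fun h' : ℝ => nambuPropagatorCT L M β μ h' K k i j) x ∧
        ‖deriv (fun h' : ℝ => nambuPropagatorCT L M β μ h' K k i j) x‖ ≤
          |dWaveSymbol L k.2| / (Λ₀ / 2) ^ 2)
    (X Y : HubbardFieldIdx L M)
    (hXY : hubbardCutoffWeightCT L M β μ K Λ₀ (momentumOf L M X) ≠ 0 ∨
      hubbardCutoffWeightCT L M β μ K Λ₀ (momentumOf L M Y) ≠ 0)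
    (h h₀ : ℝ) :
    ‖hubbardTwoPointCT L M β μ h K X Y - hubbardTwoPointCT L M β μ h₀ K X Y‖ ≤
      32 * Real.sqrt 2 * β * (L : ℝ) ^ 2 * |h - h₀| / Λ₀ ^ 2 := by
  have hAB : (Λ₀ / 2) ^ 2 ≤ matsubaraFreq β M (toNambu X).1.1.1 ^ 2 + nambuXiCT L μ K (toNambu X).1.1.2 ^ 2 ∨
      (Λ₀ / 2) ^ 2 ≤ matsubaraFreq β M (toNambu Y).1.1.1 ^ 2 + nambuXiCT L μ K (toNambu Y).1.1.2 ^ 2 := by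
    rcases hXY with hx | hy
    · left
      rw [den_toNambu]
      exact sq_half_le_of_weight_ne_zero hΛ₀ hx
    · right
      rw [den_toNambu]
      exact sq_half_le_of_weight_ne_zero hΛ₀ hy
  have h1 := norm_nambuTwoPointCT_sub_le hβ hΛ₀ hS (toNambu X) (toNambu Y) hAB h h₀
  have h2 := norm_nambuTwoPointCT_sub_le hβ hΛ₀ hS (toNambu Y) (toNambu X) hAB.symm h h₀
  unfold hubbardTwoPointCT
  calc ‖nambuTwoPointCT L M β μ h K (toNambu X) (toNambu Y) - nambuTwoPointCT L M β μ h K (toNambu Y) (toNambu X) -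
          (nambuTwoPointCT L M β μ h₀ K (toNambu X) (toNambu Y) -
            nambuTwoPointCT L M β μ h₀ K (toNambu Y) (toNambu X))‖
        = ‖(nambuTwoPointCT L M β μ h K (toNambu X) (toNambu Y) - nambuTwoPointCT L M β μ h₀ K (toNambu X) (toNambu Y)) -
            (nambuTwoPointCT L M β μ h K (toNambu Y) (toNambu X) -
              nambuTwoPointCT L M β μ h₀ K (toNambu Y) (toNambu X))‖ := by
          congr 1
          ring
    _ ≤ β * (L : ℝ) ^ 2 * (16 * Real.sqrt 2 * |h - h₀| / Λ₀ ^ 2) +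
          β * (L : ℝ) ^ 2 * (16 * Real.sqrt 2 * |h - h₀| / Λ₀ ^ 2) := (norm_sub_le _ _).trans (add_le_add h1 h2)
    _ = 32 * Real.sqrt 2 * β * (L : ℝ) ^ 2 * |h - h₀| / Λ₀ ^ 2 := by ring

/-- **S3 (`SeedSliceCovarianceBound`)**: given S1 (above a fermionic scale `Λ`, every entry of the seeded
Nambu propagator is differentiable in the seed strength with `‖∂_h G_ab‖ ≤ |φ_d|/Λ²`), every entry of the
seed-slice covariance above scale `Λ₀`, `C^{K}_{>Λ₀,h}(X,Y) − C^{K}_{>Λ₀,h₀}(X,Y)`, is bounded by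
`32√2 · βL² · |h − h₀| / Λ₀²` (`|φ_d| ≤ 4√2`; Salmhofer's `χ₂` vanishes on `[0, ¼]`, so only momenta with
`ω² + e_K² > Λ₀²/4` contribute, where S1 applies at scale `Λ₀/2`). [folklore] -/
theorem stub_seedSliceCovarianceBound :
    (∀ (L M : ℕ) [NeZero L] (β μ Λ h : ℝ) (K : TrigPolyC4v) (k : FreqMomentum L M) (i j : Fin 2),
      0 < Λ → Λ ^ 2 ≤ matsubaraFreq β M k.1 ^ 2 + nambuXiCT L μ K k.2 ^ 2 →
        DifferentiableAt ℝ (fun h' : ℝ => nambuPropagatorCT L M β μ h' K k i j) h ∧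
        ‖deriv (fun h' : ℝ => nambuPropagatorCT L M β μ h' K k i j) h‖ ≤ |dWaveSymbol L k.2| / Λ ^ 2) →
    ∀ (L M : ℕ) [NeZero L] (β μ h h₀ : ℝ) (K : TrigPolyC4v) (Λ₀ : ℝ) (X Y : HubbardFieldIdx L M),
      0 < β → 0 < Λ₀ →
        ‖hubbardCovAboveCT L M β μ h K Λ₀ X Y - hubbardCovAboveCT L M β μ h₀ K Λ₀ X Y‖ ≤
          32 * Real.sqrt 2 * β * (L : ℝ) ^ 2 * |h - h₀| / Λ₀ ^ 2 := by
  intro hS1 L M _ β μ h h₀ K Λ₀ X Y hβ hΛ₀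
  -- S1 at scale `Λ₀/2`
  have hS : ∀ (k : FreqMomentum L M) (i j : Fin 2) (x : ℝ),
      (Λ₀ / 2) ^ 2 ≤ matsubaraFreq β M k.1 ^ 2 + nambuXiCT L μ K k.2 ^ 2 →
        DifferentiableAt ℝ (fun h' : ℝ => nambuPropagatorCT L M β μ h' K k i j) x ∧
        ‖deriv (fun h' : ℝ => nambuPropagatorCT L M β μ h' K k i j) x‖ ≤
          |dWaveSymbol L k.2| / (Λ₀ / 2) ^ 2 :=
    fun k i j x hk => hS1 L M β μ (Λ₀ / 2) x K k i j (by positivity) hk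
  have hrhs : 0 ≤ 32 * Real.sqrt 2 * β * (L : ℝ) ^ 2 * |h - h₀| / Λ₀ ^ 2 := by positivity
  simp only [hubbardCovAboveCT, hubbardCovarianceCT, Matrix.of_apply]
  rw [← mul_sub, norm_mul, neg_sub_neg, norm_sub_rev]
  have hwX := salmhoferCutoff_mem_Icc
    ((matsubaraFreq β M (momentumOf L M X).1 ^ 2 + nambuXiCT L μ K (momentumOf L M X).2 ^ 2) / Λ₀ ^ 2)
  have hwY := salmhoferCutoff_mem_Icc
    ((matsubaraFreq β M (momentumOf L M Y).1 ^ 2 + nambuXiCT L μ K (momentumOf L M Y).2 ^ 2) / Λ₀ ^ 2)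
  rw [← hubbardCutoffWeightCT] at hwX hwY
  by_cases hc : hubbardCutoffWeightCT L M β μ K Λ₀ (momentumOf L M X) = 0 ∧
      hubbardCutoffWeightCT L M β μ K Λ₀ (momentumOf L M Y) = 0
  · rw [hc.1, hc.2]
    simpa using hrhs
  · have hXY : hubbardCutoffWeightCT L M β μ K Λ₀ (momentumOf L M X) ≠ 0 ∨
        hubbardCutoffWeightCT L M β μ K Λ₀ (momentumOf L M Y) ≠ 0 := by
      by_contra hne
      push Not at hne
      exact hc hne
    have hc1 : ‖(((hubbardCutoffWeightCT L M β μ K Λ₀ (momentumOf L M X) +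
        hubbardCutoffWeightCT L M β μ K Λ₀ (momentumOf L M Y)) / 2 : ℝ) : ℂ)‖ ≤ 1 := by
      rw [Complex.norm_real, Real.norm_eq_abs, abs_le]
      constructor <;> linarith [hwX.1, hwX.2, hwY.1, hwY.2]
    calc _ ≤ 1 * (32 * Real.sqrt 2 * β * (L : ℝ) ^ 2 * |h - h₀| / Λ₀ ^ 2) :=
          mul_le_mul hc1 (norm_hubbardTwoPointCT_sub_le hβ hΛ₀ hS X Y hXY h h₀) (norm_nonneg _) zero_le_one
      _ = _ := one_mul _

end Summit.HubbardSuperconductivity.HubbardSuperconductivity.Theorems.AposterioriCapRgSeededBrokenRegimeBoseFermiPinned
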